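/-
COR-CM (cell pub-hodgecm2, stage 2 of the Hodge ladder) — count-neutral KERNEL COMBINATORICS «dicyclic twist, even order: generators of the closing
span with prescribed functionals, and THE GENERATION THEOREM» (seat prover-pub-hodgecm2-b23-g43-0, binder prover b23, gen 43; claim DICYCLIC-EVEN,
HOME/INBOX.md l.10881; blanket `Census/DicyclicTwist*`).  Three bookkeeping definitions with bodies (`genX`, `genS₀`, `genE`) + theorems, on top of
`Census/DicyclicTwistEvenResidual.lean`, `Census/DicyclicTwistEvenClosing.lean` and gen 42's `Census/DicyclicTwistGenerators.lean` (`closingSpan`,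
`genU`, `genC₁` used BY NAME); no `decide`, no certificate, no named fact, no `sorry`.  `Interfaces.lean` (C1), every E term, B01, `Transposition/*`,
`PortJoin/*` untouched.
HONEST FRAMING: `HC_CM` is NOT proved, here or anywhere in the tree; nothing here is a period, a count of record or a headline.
T5: n/a-class (hypothesis binders: `|A|` even, `|A| ≥ 3`, the covering/vanishing hypotheses on `S`, `S′`); checker: self, 2026-08-23.
-/
import Summits.HodgeConjecture.CorCM.Census.DicyclicTwistEvenResidual
import Summits.HodgeConjecture.CorCM.Census.DicyclicTwistEvenClosing

/-!
# The dicyclic twist `Dic(ℤ/2 × A)`, `|A|` even, VII: the closing span realises the functionals; THE GENERATION THEOREM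

§1–§2.  With the values of part VI (`UE s (f₁ + f₂) = −[s = u′]`, `SE₁ f₁ = −2`, `SE₀ f₁x = −2`, …) the closing span `ℤ[G]f₁ + ℤ[G]f₂` of gen 42
(`Census/DicyclicTwistGenerators.lean`) contains, for `|A|` EVEN `≥ 3`:
* gen 42's `genU s = −(0, u′ − s)·(f₁ + f₂)` with `UE_t = [t = s]`, all other functionals `0` (`genU_specE`);
* **`genX s = −(0, s − u′)·(f₁x + f₂x)`** with `UX_t = [t = s]`, all other functionals `0` (`genX_spec`);
* gen 42's `genC₁ = Σ_{t ∉ P∪{u,u′}} genU t − f₁` with `SE₁ = 2`, all other functionals `0` (`genC₁_specE`);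
* **`genS₀ = Σ_{t ∉ P∪{u,u′}} genX t − f₁x`** with `SE₀ = 2`, all other functionals `0` (`genS₀_spec`);
* hence **`genE a a' k₀ k₁`** with `(UE_t, UX_t, SE₀, SE₁) = (a t, a' t, 2k₀, 2k₁)` (`genE_spec`, `genE_mem`) — every value of the four functionals
  with EVEN `SE₀`, `SE₁` (the parity of part V) is realised inside the closing span.

§3–§4.  **THEOREM (`hodge₂_le_even`).**  Let `|A|` be even, `|A| ≥ 3` (so `≥ 4`).  Let `S′ ≤ S ≤ H₂` be submodules of the Hodge lattice of the
model such that `S` contains through EVERY label of potential `≥ 2` a vector which is `1` there and otherwise supported in smaller potential, `S′`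
contains such a vector through every label of potential `≥ 2` OFF the double equator (potential `< |A|`), and the four functionals `UE s`, `UX s`,
`SE₀`, `SE₁` vanish on `S′`.  Then

  `H₂ ≤ P₂ ⊔ S ⊔ closingSpan`.

No vanishing whatsoever is asked of `S` (the double-equator squares are NOT killed by `SE₀`, `SE₁`): the proof descends a Hodge vector `y` to a
normal residual vector `r₁` through `S` (§3, `exists_normal_plain`), realises the functionals of `r₁` inside the closing span by §2
(`n = genE …`, using the parity of part V for `SE₀`, `SE₁`), descends `n` — supported in potential `≤ |A|/2` by part VI — through `S′` to a normal
residual `r₂` with THE SAME functionals (§3, `exists_normal_killed`, a bounded descent `descent₂_le`), and concludes `r₁ = r₂` from the key lemma of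
part V.  Part VIII (`Census/DicyclicTwistEvenCount.lean`) instantiates `S`, `S′` with one rule face per block.  All [folklore].

## References
* [Pohlmann1968] H. Pohlmann, Algebraic cycles on abelian varieties of complex multiplication type, Ann. of Math. 88 (1968), Thm 1.
-/

namespace Summit.HodgeConjecture.CorCM.Census.DicyclicTwist

open Finset
open Summit.HodgeConjecture.CorCM.Census.OddSliceFacesModel
open Summit.HodgeConjecture.CorCM.Census.OddSliceFacesSquares
open Summit.HodgeConjecture.CorCM.Census.OddSliceFacesDescent
open Summit.HodgeConjecture.CorCM.Census.EvenSliceFacesDescent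

variable (A : Type) [AddCommGroup A] [Fintype A] [DecidableEq A]

/-! ## §1 The generators -/

/-- **`genX s`**: `UX_t = [t = s]`, all other functionals `0` (the mirror of gen 42's `genU`). [folklore] -/
noncomputable def genX (s : A) : Ty₂ A → ℤ := -translH A (0, s - (closData A).2.2.1) (f₁x A + f₂x A)

/-- **`genS₀`**: `SE₀ = 2`, all other functionals `0`. [folklore] -/
noncomputable def genS₀ : Ty₂ A → ℤ :=
  (∑ t ∈ univ.filter fun t => ¬ (t = (closData A).2.2.1 ∨ t = (closData A).2.1 ∨ t ∈ (closData A).1), genX A t) - f₁x A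

/-- **`genE a a' k₀ k₁`**: the element of the closing span with functionals `(a, a', 2k₀, 2k₁)`. [folklore] -/
noncomputable def genE (a a' : A → ℤ) (k₀ k₁ : ℤ) : Ty₂ A → ℤ :=
  ∑ s : A, a s • genU A s + ∑ s : A, a' s • genX A s + k₀ • genS₀ A + k₁ • genC₁ A

/-- The generators lie in the closing span. [folklore] -/
theorem genX_mem (s : A) : genX A s ∈ closingSpan A ∧ genS₀ A ∈ closingSpan A := by
  have hX : ∀ t, genX A t ∈ closingSpan A := fun t => by
    unfold genX
    refine Submodule.neg_mem _ ?_
    rw [← translHHom_apply, map_add, translHHom_apply, translHHom_apply]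
    exact Submodule.add_mem _ (translH_f₁x_mem A _) (translH_f₂x_mem A _)
  exact ⟨hX s, Submodule.sub_mem _ (Submodule.sum_mem _ fun t _ => hX t) (f_mem A).2.2.1⟩

/-- `genE` lies in the closing span. [folklore] -/
theorem genE_mem (a a' : A → ℤ) (k₀ k₁ : ℤ) : genE A a a' k₀ k₁ ∈ closingSpan A := by
  unfold genE
  refine Submodule.add_mem _ (Submodule.add_mem _ (Submodule.add_mem _ ?_ ?_) ?_) ?_
  · exact Submodule.sum_mem _ fun s _ => Submodule.smul_mem _ _ (gen_mem A s).1
  · exact Submodule.sum_mem _ fun s _ => Submodule.smul_mem _ _ (genX_mem A s).1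
  · exact Submodule.smul_mem _ _ (genX_mem A (0 : A)).2
  · exact Submodule.smul_mem _ _ (gen_mem A (0 : A)).2.2.1

/-! ## §2 Their functionals, `|A|` even -/

section Even

variable {A}
variable (hev : Even (Fintype.card A)) (h3 : 3 ≤ Fintype.card A)
include hev h3

/-- **`genU s` (gen 42) read by the strict-half functionals**: `UE_t = [t = s]`, `UX_t = 0`, `SE₀ = SE₁ = 0`. [folklore] -/
theorem genU_specE (s t : A) :
    UE A t (genU A s) = (if t = s then 1 else 0) ∧ UX A t (genU A s) = 0 ∧ SE₀ A (genU A s) = 0 ∧ SE₁ A (genU A s) = 0 := by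
  unfold genU
  rw [map_neg, map_neg, map_neg, map_neg, UE_translH_zero, UX_translH_zero, SE₀_translH_zero, SE₁_translH_zero]
  obtain ⟨hE, hX, h1, h0⟩ := functionals_f₁_add_f₂ hev h3 (t + ((closData A).2.2.1 - s))
  obtain ⟨-, hX', -, -⟩ := functionals_f₁_add_f₂ hev h3 (t - ((closData A).2.2.1 - s))
  rw [hE, hX', h0, h1]
  refine ⟨?_, by ring, by ring, by ring⟩
  by_cases hts : t = s
  · subst hts; simp
  · rw [if_neg (fun h => hts (by rw [eq_sub_of_add_eq h, sub_sub_cancel])), if_neg hts]; ring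

/-- **`genX s`**: `UX_t = [t = s]`, `UE_t = 0`, `SE₀ = SE₁ = 0`. [folklore] -/
theorem genX_spec (s t : A) :
    UE A t (genX A s) = 0 ∧ UX A t (genX A s) = (if t = s then 1 else 0) ∧ SE₀ A (genX A s) = 0 ∧ SE₁ A (genX A s) = 0 := by
  unfold genX
  rw [map_neg, map_neg, map_neg, map_neg, UE_translH_zero, UX_translH_zero, SE₀_translH_zero, SE₁_translH_zero, map_add, map_add,
    map_add, map_add]
  obtain ⟨⟨aE, aX, a0, a1⟩, ⟨bE, bX, b0, b1⟩⟩ := functionals_fx hev h3 (t + (s - (closData A).2.2.1))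
  obtain ⟨⟨-, cX, -, -⟩, ⟨-, dX, -, -⟩⟩ := functionals_fx hev h3 (t - (s - (closData A).2.2.1))
  rw [aE, bE, cX, dX, a0, b0, a1, b1, ← map_add, (functionals_f₁_add_f₂ hev h3 _).1]
  refine ⟨by ring, ?_, by ring, by ring⟩
  by_cases hts : t = s
  · subst hts; simp
  · rw [if_neg (fun h => hts (by have := congrArg (· + (s - (closData A).2.2.1)) h; simp at this; exact this)), if_neg hts]; ring

/-- **`genC₁` (gen 42)**: `SE₁ = 2`, `UE = UX = 0`, `SE₀ = 0`. [folklore] -/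
theorem genC₁_specE (t : A) : UE A t (genC₁ A) = 0 ∧ UX A t (genC₁ A) = 0 ∧ SE₀ A (genC₁ A) = 0 ∧ SE₁ A (genC₁ A) = 2 := by
  obtain ⟨fE, fX, f1, f0⟩ := functionals_f₁ hev h3 t
  have gU := fun s => genU_specE hev h3 s t
  unfold genC₁
  refine ⟨?_, ?_, ?_, ?_⟩
  · rw [map_sub, map_sum, fE, Finset.sum_congr rfl fun s _ => (gU s).1, Finset.sum_ite_eq]
    simp only [Finset.mem_filter, Finset.mem_univ, true_and]
    by_cases h : t = (closData A).2.2.1 ∨ t = (closData A).2.1 ∨ t ∈ (closData A).1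
    · rw [if_neg (not_not_intro h), if_pos h]; ring
    · rw [if_pos h, if_neg h]; ring
  · rw [map_sub, map_sum, fX, Finset.sum_congr rfl fun s _ => (gU s).2.1, Finset.sum_const_zero, sub_zero]
  · rw [map_sub, map_sum, f0, Finset.sum_congr rfl fun s _ => (gU s).2.2.1, Finset.sum_const_zero, sub_zero]
  · rw [map_sub, map_sum, f1, Finset.sum_congr rfl fun s _ => (gU s).2.2.2, Finset.sum_const_zero]; ring

/-- **`genS₀`**: `SE₀ = 2`, `UE = UX = 0`, `SE₁ = 0`. [folklore] -/
theorem genS₀_spec (t : A) : UE A t (genS₀ A) = 0 ∧ UX A t (genS₀ A) = 0 ∧ SE₀ A (genS₀ A) = 2 ∧ SE₁ A (genS₀ A) = 0 := by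
  obtain ⟨fE, -, -, -⟩ := functionals_f₁ hev h3 t
  obtain ⟨⟨xE, xX, x0, x1⟩, -⟩ := functionals_fx hev h3 t
  have gX := fun s => genX_spec hev h3 s t
  unfold genS₀
  refine ⟨?_, ?_, ?_, ?_⟩
  · rw [map_sub, map_sum, xE, Finset.sum_congr rfl fun s _ => (gX s).1, Finset.sum_const_zero, sub_zero]
  · rw [map_sub, map_sum, xX, fE, Finset.sum_congr rfl fun s _ => (gX s).2.1, Finset.sum_ite_eq]
    simp only [Finset.mem_filter, Finset.mem_univ, true_and]
    by_cases h : t = (closData A).2.2.1 ∨ t = (closData A).2.1 ∨ t ∈ (closData A).1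
    · rw [if_neg (not_not_intro h), if_pos h]; ring
    · rw [if_pos h, if_neg h]; ring
  · rw [map_sub, map_sum, x0, Finset.sum_congr rfl fun s _ => (gX s).2.2.1, Finset.sum_const_zero]; ring
  · rw [map_sub, map_sum, x1, Finset.sum_congr rfl fun s _ => (gX s).2.2.2, Finset.sum_const_zero, sub_zero]

/-- **The functionals of `genE a a' k₀ k₁` are `(a, a', 2k₀, 2k₁)`.** [folklore] -/
theorem genE_spec (a a' : A → ℤ) (k₀ k₁ : ℤ) (t : A) :
    UE A t (genE A a a' k₀ k₁) = a t ∧ UX A t (genE A a a' k₀ k₁) = a' t ∧ SE₀ A (genE A a a' k₀ k₁) = 2 * k₀ ∧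
      SE₁ A (genE A a a' k₀ k₁) = 2 * k₁ := by
  have gU := fun s => genU_specE hev h3 s t
  have gX := fun s => genX_spec hev h3 s t
  have gC := genC₁_specE hev h3 t
  have gS := genS₀_spec hev h3 t
  unfold genE
  refine ⟨?_, ?_, ?_, ?_⟩
  · simp only [map_add, map_sum, map_zsmul, smul_eq_mul, fun s => (gU s).1, fun s => (gX s).1, gC.1, gS.1, mul_zero,
      Finset.sum_const_zero, add_zero, mul_ite, mul_one]
    rw [Finset.sum_ite_eq univ t, if_pos (Finset.mem_univ _)]
  · simp only [map_add, map_sum, map_zsmul, smul_eq_mul, fun s => (gU s).2.1, fun s => (gX s).2.1, gC.2.1, gS.2.1, mul_zero,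
      Finset.sum_const_zero, add_zero, zero_add, mul_ite, mul_one]
    rw [Finset.sum_ite_eq univ t, if_pos (Finset.mem_univ _)]
  · simp only [map_add, map_sum, map_zsmul, smul_eq_mul, fun s => (gU s).2.2.1, fun s => (gX s).2.2.1, gC.2.2.1, gS.2.2.1, mul_zero,
      Finset.sum_const_zero, add_zero, zero_add]
    ring
  · simp only [map_add, map_sum, map_zsmul, smul_eq_mul, fun s => (gU s).2.2.2, fun s => (gX s).2.2.2, gC.2.2.2, gS.2.2.2, mul_zero,
      Finset.sum_const_zero, add_zero, zero_add]
    ring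

end Even

/-! ## §3 Descents -/

omit [AddCommGroup A] in
/-- **Bounded descent.**  If `S` covers every label of potential `2 ≤ · ≤ K`, a vector supported in potential `≤ K` is congruent modulo `S` to a
vector supported on the residual labels. [folklore] -/
theorem descent₂_le (S : Submodule ℤ (Ty₂ A → ℤ)) (K : ℕ)
    (hcover : ∀ Ψ : Ty₂ A, 2 ≤ pot A Ψ → pot A Ψ ≤ K → ∃ v ∈ S, v Ψ = 1 ∧ ∀ χ, χ ≠ Ψ → v χ ≠ 0 → pot A χ < pot A Ψ)
    (m : Ty₂ A → ℤ) (hm : ∀ χ, m χ ≠ 0 → pot A χ ≤ K) :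
    ∃ r : Ty₂ A → ℤ, (∀ χ, r χ ≠ 0 → pot A χ ≤ 1) ∧ m - r ∈ S := by
  induction K generalizing m with
  | zero => exact ⟨m, fun χ h => (hm χ h).trans (Nat.zero_le 1), by rw [sub_self]; exact Submodule.zero_mem _⟩
  | succ K ih =>
    by_cases hK1 : K + 1 ≤ 1
    · exact ⟨m, fun χ h => (hm χ h).trans hK1, by rw [sub_self]; exact Submodule.zero_mem _⟩
    · obtain ⟨m', hm', hdiff⟩ := clear_step₂ A S (K := K + 1) (by omega)
        (fun Ψ hΨ => by
          obtain ⟨v, hv, h1, h2⟩ := hcover Ψ (by omega) (le_of_eq hΨ)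
          exact ⟨v, hv, h1, fun χ hχ hz => by rw [← hΨ]; exact h2 χ hχ hz⟩) m hm
      obtain ⟨r, hr, hdiff'⟩ := ih (fun Ψ h2 hK => hcover Ψ h2 (by omega)) m' (fun χ h => by have := hm' χ h; omega)
      refine ⟨r, hr, ?_⟩
      have : m - r = (m - m') + (m' - r) := by abel
      rw [this]
      exact Submodule.add_mem _ hdiff hdiff'

/-- **Plain normal reduction**: modulo `S ⊔ P₂` every Hodge vector is congruent to a Hodge vector on the normal residual labels (`S ≤ H₂` covering
all labels of potential `≥ 2`; `|A| ≥ 3`). [folklore] -/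
theorem exists_normal_plain (h3 : 3 ≤ Fintype.card A) (S : Submodule ℤ (Ty₂ A → ℤ)) (hSH : S ≤ hodge₂ A)
    (hcover : ∀ Ψ : Ty₂ A, 2 ≤ pot A Ψ → ∃ v ∈ S, v Ψ = 1 ∧ ∀ χ, χ ≠ Ψ → v χ ≠ 0 → pot A χ < pot A Ψ) {y : Ty₂ A → ℤ}
    (hy : y ∈ hodge₂ A) :
    ∃ r : Ty₂ A → ℤ, (∀ Ψ, r Ψ ≠ 0 → pot A Ψ ≤ 1) ∧ (∀ Ψ, r Ψ ≠ 0 → wt A Ψ.1 ≤ Fintype.card A / 2) ∧ r ∈ hodge₂ A ∧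
      y - r ∈ S ⊔ pairs₂ A := by
  obtain ⟨r₀, hr₀, hyr₀⟩ := descent₂ A S hcover (Fintype.card A) y (fun χ _ => pot_le A χ)
  have hp : r₀ - nrm₂ A r₀ ∈ pairs₂ A := sub_nrm₂_mem_of_residual A h3 hr₀
  refine ⟨nrm₂ A r₀, fun Ψ h => ?_, fun Ψ h => isLow_of_nrm₂_ne_zero A r₀ h, ?_, ?_⟩
  · rcases nrm₂_ne_zero A r₀ h with h' | h'
    · exact hr₀ Ψ h'
    · rw [← pot_conj]; exact hr₀ _ h'
  · have e : nrm₂ A r₀ = y - (y - r₀) - (r₀ - nrm₂ A r₀) := by abel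
    rw [e]
    exact Submodule.sub_mem _ (Submodule.sub_mem _ hy (hSH hyr₀)) (pairs₂_le_hodge₂ A hp)
  · have e : y - nrm₂ A r₀ = (y - r₀) + (r₀ - nrm₂ A r₀) := by abel
    rw [e]
    exact Submodule.add_mem _ (Submodule.mem_sup_left hyr₀) (Submodule.mem_sup_right hp)

/-- **Killed normal reduction below the double equator**: a Hodge vector supported in potential `≤ |A|/2` is congruent modulo `S′ ⊔ P₂` to a
normal residual Hodge vector with the same four functionals, when `S′ ≤ H₂` covers every label of potential `2 ≤ · < |A|` and is killed by the four
functionals (`|A| ≥ 3`). [folklore] -/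
theorem exists_normal_killed (h3 : 3 ≤ Fintype.card A) (S' : Submodule ℤ (Ty₂ A → ℤ)) (hSH : S' ≤ hodge₂ A)
    (hcover : ∀ Ψ : Ty₂ A, 2 ≤ pot A Ψ → pot A Ψ < Fintype.card A → ∃ v ∈ S', v Ψ = 1 ∧ ∀ χ, χ ≠ Ψ → v χ ≠ 0 → pot A χ < pot A Ψ)
    (hkill : ∀ v ∈ S', (∀ s, UE A s v = 0) ∧ (∀ s, UX A s v = 0) ∧ SE₀ A v = 0 ∧ SE₁ A v = 0) {n : Ty₂ A → ℤ} (hn : n ∈ hodge₂ A)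
    (hsupp : ∀ χ, n χ ≠ 0 → pot A χ ≤ Fintype.card A / 2) :
    ∃ r : Ty₂ A → ℤ, (∀ Ψ, r Ψ ≠ 0 → pot A Ψ ≤ 1) ∧ (∀ Ψ, r Ψ ≠ 0 → wt A Ψ.1 ≤ Fintype.card A / 2) ∧ r ∈ hodge₂ A ∧
      n - r ∈ S' ⊔ pairs₂ A ∧ ((∀ s, UE A s (n - r) = 0) ∧ (∀ s, UX A s (n - r) = 0) ∧ SE₀ A (n - r) = 0 ∧ SE₁ A (n - r) = 0) := by
  obtain ⟨r₀, hr₀, hnr₀⟩ := descent₂_le A S' (Fintype.card A / 2) (fun Ψ h2 hK => hcover Ψ h2 (by omega)) n hsupp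
  have hp : r₀ - nrm₂ A r₀ ∈ pairs₂ A := sub_nrm₂_mem_of_residual A h3 hr₀
  refine ⟨nrm₂ A r₀, fun Ψ h => ?_, fun Ψ h => isLow_of_nrm₂_ne_zero A r₀ h, ?_, ?_, ?_⟩
  · rcases nrm₂_ne_zero A r₀ h with h' | h'
    · exact hr₀ Ψ h'
    · rw [← pot_conj]; exact hr₀ _ h'
  · have e : nrm₂ A r₀ = n - (n - r₀) - (r₀ - nrm₂ A r₀) := by abel
    rw [e]
    exact Submodule.sub_mem _ (Submodule.sub_mem _ hn (hSH hnr₀)) (pairs₂_le_hodge₂ A hp)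
  · have e : n - nrm₂ A r₀ = (n - r₀) + (r₀ - nrm₂ A r₀) := by abel
    rw [e]
    exact Submodule.add_mem _ (Submodule.mem_sup_left hnr₀) (Submodule.mem_sup_right hp)
  · have e : n - nrm₂ A r₀ = (n - r₀) - (-(r₀ - nrm₂ A r₀)) := by abel
    rw [e]
    exact killedE_sub A (hkill _ hnr₀) (killedE_of_mem_pairs₂ A (Submodule.neg_mem _ hp))

/-! ## §4 The generation theorem -/

/-- **THE GENERATION THEOREM of the dicyclic twist, `|A|` even.**  For `|A|` even `≥ 3`, submodules `S′ ≤ S ≤ H₂` with `S` covering every label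
of potential `≥ 2`, `S′` covering every such label off the double equator and killed by `UE`, `UX`, `SE₀`, `SE₁`:  `H₂ ≤ P₂ ⊔ S ⊔ closingSpan`.
[folklore] -/
theorem hodge₂_le_even (hev : Even (Fintype.card A)) (h3 : 3 ≤ Fintype.card A) (S S' : Submodule ℤ (Ty₂ A → ℤ)) (hS'S : S' ≤ S)
    (hSH : S ≤ hodge₂ A) (hcover : ∀ Ψ : Ty₂ A, 2 ≤ pot A Ψ → ∃ v ∈ S, v Ψ = 1 ∧ ∀ χ, χ ≠ Ψ → v χ ≠ 0 → pot A χ < pot A Ψ)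
    (hcover' : ∀ Ψ : Ty₂ A, 2 ≤ pot A Ψ → pot A Ψ < Fintype.card A → ∃ v ∈ S', v Ψ = 1 ∧ ∀ χ, χ ≠ Ψ → v χ ≠ 0 → pot A χ < pot A Ψ)
    (hkill' : ∀ v ∈ S', (∀ s, UE A s v = 0) ∧ (∀ s, UX A s v = 0) ∧ SE₀ A v = 0 ∧ SE₁ A v = 0) :
    hodge₂ A ≤ pairs₂ A ⊔ S ⊔ closingSpan A := by
  intro y hy
  have hS'H : S' ≤ hodge₂ A := hS'S.trans hSH
  -- (1) plain normal reduction of `y`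
  obtain ⟨r₁, hr₁p, hr₁l, hr₁H, hyr₁⟩ := exists_normal_plain A h3 S hSH hcover hy
  -- (2) the element of the closing span with the functionals of `r₁`
  obtain ⟨⟨k₀, hk₀⟩, ⟨k₁, hk₁⟩⟩ := two_dvd_SE h3 hr₁p hr₁l hr₁H
  set n := genE A (fun s => UE A s r₁) (fun s => UX A s r₁) k₀ k₁ with hn
  have hnspec := genE_spec hev h3 (fun s => UE A s r₁) (fun s => UX A s r₁) k₀ k₁
  have hnH : n ∈ hodge₂ A := closingSpan_le_hodge₂ A h3 (genE_mem A _ _ _ _)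
  -- (3) killed normal reduction of `n` (supported below the double equator)
  obtain ⟨r₂, hr₂p, hr₂l, hr₂H, hnr₂, hk⟩ := exists_normal_killed A h3 S' hS'H hcover' hkill' hnH
    (pot_le_half_of_mem_closingSpan A (genE_mem A _ _ _ _))
  -- (4) `r₁ − r₂` is a killed normal residual Hodge vector, hence zero
  have hd : r₁ - r₂ = 0 := by
    refine eq_zero_of_normal_killed h3 (r := r₁ - r₂) (fun Ψ h => ?_) (fun Ψ h => ?_) (Submodule.sub_mem _ hr₁H hr₂H) ?_
    · by_cases h1 : r₁ Ψ = 0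
      · exact hr₂p Ψ (by rw [Pi.sub_apply, h1, zero_sub] at h; exact fun hz => h (by rw [hz, neg_zero]))
      · exact hr₁p Ψ h1
    · by_cases h1 : r₁ Ψ = 0
      · exact hr₂l Ψ (by rw [Pi.sub_apply, h1, zero_sub] at h; exact fun hz => h (by rw [hz, neg_zero]))
      · exact hr₁l Ψ h1
    · have hr₂v : (∀ s, UE A s r₂ = UE A s r₁) ∧ (∀ s, UX A s r₂ = UX A s r₁) ∧ SE₀ A r₂ = SE₀ A r₁ ∧ SE₁ A r₂ = SE₁ A r₁ := by
        refine ⟨fun s => ?_, fun s => ?_, ?_, ?_⟩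
        · have := hk.1 s; rw [map_sub, (hnspec s).1] at this; linarith
        · have := hk.2.1 s; rw [map_sub, (hnspec s).2.1] at this; linarith
        · have := hk.2.2.1; rw [map_sub, (hnspec (0 : A)).2.2.1] at this; linarith
        · have := hk.2.2.2; rw [map_sub, (hnspec (0 : A)).2.2.2] at this; linarith
      exact ⟨fun s => by rw [map_sub, hr₂v.1 s, sub_self], fun s => by rw [map_sub, hr₂v.2.1 s, sub_self],
        by rw [map_sub, hr₂v.2.2.1, sub_self], by rw [map_sub, hr₂v.2.2.2, sub_self]⟩
  have hr : r₁ = r₂ := sub_eq_zero.mp hd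
  -- (5) assemble: `y = (y − r₁) + (n − (n − r₂))`
  have e : y = (y - r₁) + n - (n - r₂) := by rw [hr]; abel
  rw [e]
  refine Submodule.sub_mem _ (Submodule.add_mem _ ?_ (Submodule.mem_sup_right (genE_mem A _ _ _ _))) ?_
  · rcases Submodule.mem_sup.mp hyr₁ with ⟨s₁, hs₁, p₁, hp₁, hsp⟩
    rw [← hsp]
    exact Submodule.mem_sup_left (Submodule.add_mem _ (Submodule.mem_sup_right hs₁) (Submodule.mem_sup_left hp₁))
  · rcases Submodule.mem_sup.mp hnr₂ with ⟨s₂, hs₂, p₂, hp₂, hsp⟩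
    rw [← hsp]
    exact Submodule.mem_sup_left (Submodule.add_mem _ (Submodule.mem_sup_right (hS'S hs₂)) (Submodule.mem_sup_left hp₂))

end Summit.HodgeConjecture.CorCM.Census.DicyclicTwist
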